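import Literature.AlgebraicTopology.SingularHomology.UniversalCoefficientsField
import HarnessLib

/-!
# Over a field, polynomial relations of `f_*` on `Hₙ` transfer to `f^*` on `Hⁿ` (Kronecker duality)

Layer `Literature/AlgebraicTopology/SingularHomology`; theorems only (no definition, no named fact). Written by the
prover seat `hodge-nonav-prover-Ax` (g9) for the programme "localisation of the nodal meridian monodromy" of the route
`Summits/HodgeConjecture/HodgeConjecture/Theses/CyclicUnitaryPowers.lean` (crux K1): the tree's local model of the
`A_{p−1}` Milnor fibre (`Geometry/ComplexAnalytic/PhamBrieskorn*`) is stated in singular HOMOLOGY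
(`Σ_{i<p} σ_*^i = 0` on `H₂(F; ℚ)`, `dim H₂(F; ℚ) = p − 1`), while monodromy acts on the COHOMOLOGY of the fibres
(`singularCohomology ℚ ℚ`); this file is the bridge.

A. Hatcher, *Algebraic Topology* (2002), §3.1 Thm. 3.2 / p. 198 / p. 201: over a field `F` the Kronecker map
`Hⁿ(X; F) → Hom(Hₙ(X; F), F)` is injective (indeed bijective; tree: `kroneckerPairing_injective_of_field`,
`kroneckerPairing_bijective_of_field`) and natural (`kroneckerPairing_map`: `⟨f^* a, c⟩ = ⟨a, f_* c⟩`). Hence for a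
self-map `f : X → X`:

* `kroneckerPairing_pow_cohomologyMap` — `⟨(f^*)^i a, c⟩ = ⟨a, (f_*)^i c⟩`;
* `sum_smul_pow_cohomologyMap_eq_zero` — **if `Σ_i c_i (f_*)^i = 0` on `Hₙ(X; F)` then `Σ_i c_i (f^*)^i = 0` on
  `Hⁿ(X; F)`**; `sum_pow_cohomologyMap_eq_zero` — the case `c_i = 1` (`1 + f + ⋯ + f^{m−1}`);
* `finite_singularCohomology_of_field` — `Hⁿ(X; F)` is finite-dimensional when `Hₙ(X; F)` is, and then
  `finrank_singularCohomology_eq_bettiNumber_of_field` (tree) gives `dim Hⁿ = dim Hₙ`.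

## References

* [HatcherAT2002] A. Hatcher, Algebraic Topology, CUP 2002, §3.1 Thm. 3.2 (p. 195), p. 198, p. 201.
-/

noncomputable section

open CategoryTheory

universe u v

namespace Literature.AlgebraicTopology.SingularHomology

variable (F : Type v) [Field F] {X : Type u} [TopologicalSpace X]

/-- **`⟨(f^*)^i a, c⟩ = ⟨a, (f_*)^i c⟩`**: naturality of the Kronecker pairing, iterated.
[cite: HatcherAT2002, §3.1 p. 201] -/
theorem kroneckerPairing_pow_cohomologyMap (f : C(X, X)) (n i : ℕ) (a : singularCohomology F F X n)
    (c : singularHomology F F X n) :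
    kroneckerPairing F F X n (((singularCohomology.map F F f n).hom ^ i) a) c =
      kroneckerPairing F F X n a (((singularHomology.map F F f n).hom ^ i) c) := by
  induction i generalizing a c with
  | zero => rw [pow_zero, pow_zero, Module.End.one_apply, Module.End.one_apply]
  | succ i ih =>
    rw [pow_succ, Module.End.mul_apply, ih, pow_succ', Module.End.mul_apply]
    exact kroneckerPairing_map f a _

/-- **Polynomial relations transfer from homology to cohomology over a field**: if
`Σ_{i<m} c_i (f_*)^i = 0` on `Hₙ(X; F)` then `Σ_{i<m} c_i (f^*)^i = 0` on `Hⁿ(X; F)` (pair with any `c ∈ Hₙ` and use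
the injectivity of the Kronecker map). [cite: HatcherAT2002, §3.1 Thm. 3.2 (p. 195), p. 198 and p. 201] -/
theorem sum_smul_pow_cohomologyMap_eq_zero (f : C(X, X)) (n m : ℕ) (c : ℕ → F)
    (h : ∀ z : singularHomology F F X n,
      ∑ i ∈ Finset.range m, c i • ((singularHomology.map F F f n).hom ^ i) z = 0)
    (a : singularCohomology F F X n) :
    ∑ i ∈ Finset.range m, c i • ((singularCohomology.map F F f n).hom ^ i) a = 0 := by
  apply kroneckerPairing_injective_of_field F X n
  rw [map_zero]
  refine LinearMap.ext fun z => ?_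
  rw [map_sum, LinearMap.sum_apply, LinearMap.zero_apply]
  have key : ∀ i ∈ Finset.range m,
      kroneckerPairing F F X n (c i • ((singularCohomology.map F F f n).hom ^ i) a) z =
        kroneckerPairing F F X n a (c i • ((singularHomology.map F F f n).hom ^ i) z) := by
    intro i _
    rw [map_smul, LinearMap.smul_apply, kroneckerPairing_pow_cohomologyMap, ← map_smul]
  rw [Finset.sum_congr rfl key, ← map_sum, h z, map_zero]

/-- The case `c_i = 1`: if `1 + f_* + ⋯ + f_*^{m−1} = 0` on `Hₙ(X; F)` then `1 + f^* + ⋯ + (f^*)^{m−1} = 0` on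
`Hⁿ(X; F)`. [cite: HatcherAT2002, §3.1 Thm. 3.2 (p. 195), p. 198 and p. 201] -/
theorem sum_pow_cohomologyMap_eq_zero (f : C(X, X)) (n m : ℕ)
    (h : ∀ z : singularHomology F F X n, ∑ i ∈ Finset.range m, ((singularHomology.map F F f n).hom ^ i) z = 0)
    (a : singularCohomology F F X n) :
    ∑ i ∈ Finset.range m, ((singularCohomology.map F F f n).hom ^ i) a = 0 := by
  have h' := sum_smul_pow_cohomologyMap_eq_zero F f n m (fun _ => (1 : F))
    (fun z => by simpa only [one_smul] using h z) a
  simpa only [one_smul] using h'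

/-- **`Hⁿ(X; F)` is finite-dimensional when `Hₙ(X; F)` is** (it is the dual space, Kronecker bijection).
[cite: HatcherAT2002, §3.1 Thm. 3.2 (p. 195) and p. 198] -/
theorem finite_singularCohomology_of_field (n : ℕ) [Module.Finite F (singularHomology F F X n)] :
    Module.Finite F (singularCohomology F F X n) :=
  Module.Finite.equiv (LinearEquiv.ofBijective _ (kroneckerPairing_bijective_of_field F X n)).symm

end Literature.AlgebraicTopology.SingularHomology

end
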